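import Mathlib.RingTheory.Nullstellensatz
import Mathlib.Algebra.MvPolynomial.NoZeroDivisors
import Mathlib.Algebra.MvPolynomial.Nilpotent
import Mathlib.RingTheory.Polynomial.UniqueFactorization
import Mathlib.LinearAlgebra.Basis.VectorSpace
import HarnessLib

/-!
# Polynomials vanishing on rational points are spanned by rational polynomials

Let `k → L` be a field extension and `A ⊆ k^ι` a set of `k`-rational points. Expanding the
coefficients of a polynomial `f ∈ L[X_ι]` in a `k`-basis of `L` shows:

* `exists_sum_smul_map_of_forall_aeval_eq_zero` — if `f` vanishes on (the image in `L^ι` of) `A`,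
  then `f = ∑ cᵢ • gᵢ` with `cᵢ ∈ L` and `gᵢ ∈ k[X_ι]` polynomials **vanishing on `A`** whose
  supports are contained in the support of `f` (so `deg gᵢ ≤ deg f`). In other words the ideal of
  `L`-polynomials vanishing on a set of `k`-points is generated, degree by degree, by its
  `k`-rational elements (the Zariski closure of a set of `k`-points is defined over `k`).
* `exists_eq_C_mul_map_of_forall_dvd` — consequently, if such an `f ≠ 0` divides every
  `L`-polynomial vanishing on `A` (e.g. `f` generates the vanishing ideal of `A`), then `f` is an
  `L`-multiple of a `k`-polynomial.
* `prime_map_of_isAlgClosed` — **absolute irreducibility over an algebraically closed field**: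
  if `k` is algebraically closed, a prime `G ∈ k[X_ι]` (finitely many variables) stays prime in
  `L[X_ι]` for every extension `L` of `k`. (If `G = A · B` over `L`, the two factors vanish on
  complementary parts of the `k`-points of `Z(G)`; by the first result there are `k`-polynomials
  `A₁, B₁` of no larger degrees doing the same, so `G ∣ A₁ B₁` by the Nullstellensatz over `k`,
  and a degree count forces `A` or `B` to be constant.)

These are the standard linear-algebra facts behind "`k`-closed sets are defined over `k`" and
"irreducible over `k̄` implies geometrically irreducible" (e.g. Görtz–Wedhorn, *Algebraic
Geometry I*, §5; Marker, *Model theory of fields*, §1), recorded here in the elementary form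
needed for plane curves in transcendence arguments.
-/

namespace Literature.RingTheory.Nullstellensatz

open MvPolynomial

noncomputable section

variable {k L : Type*} [Field k] [Field L] [Algebra k L] {ι : Type*}

/-- Evaluating a `k`-polynomial at the image in `L^ι` of a `k`-point gives the image of its value.
[folklore] -/
theorem aeval_algebraMap_comp_eq (a : ι → k) (p : MvPolynomial ι k) :
    aeval (fun i => algebraMap k L (a i)) p = algebraMap k L (eval a p) := by
  rw [map_eval, eval_map]
  rfl

/-- The total degree is monotone in the support. [folklore] -/
theorem totalDegree_le_of_support_subset {R S : Type*} [CommSemiring R] [CommSemiring S]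
    {p : MvPolynomial ι R} {q : MvPolynomial ι S} (h : p.support ⊆ q.support) :
    p.totalDegree ≤ q.totalDegree :=
  Finset.sup_mono h

/-- **`L`-polynomials vanishing on `k`-points are combinations of `k`-polynomials vanishing
there.** If `f ∈ L[X_ι]` vanishes on the set `A ⊆ k^ι` of `k`-rational points, then
`f = ∑ᵢ cᵢ • gᵢ` with `cᵢ ∈ L`, `gᵢ ∈ k[X_ι]` vanishing on `A` and `supp gᵢ ⊆ supp f`
(expand the coefficients of `f` in a `k`-basis of `L`). [folklore] -/
theorem exists_sum_smul_map_of_forall_aeval_eq_zero (A : Set (ι → k)) (f : MvPolynomial ι L)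
    (hf : ∀ a ∈ A, aeval (fun i => algebraMap k L (a i)) f = 0) :
    ∃ (n : ℕ) (c : Fin n → L) (g : Fin n → MvPolynomial ι k),
      f = ∑ i, c i • map (algebraMap k L) (g i) ∧
      (∀ i, ∀ a ∈ A, eval a (g i) = 0) ∧
      (∀ i, (g i).support ⊆ f.support) := by
  classical
  let J : Set L := Module.Basis.ofVectorSpaceIndex k L
  set b : Module.Basis J k L := Module.Basis.ofVectorSpace k L with hb
  -- the finitely many basis vectors occurring in the coefficients of `f`
  let S : Finset J := f.support.biUnion fun m => (b.repr (f.coeff m)).support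
  -- the `k`-polynomial collecting the `β`-components of the coefficients of `f`
  let g₀ : J → MvPolynomial ι k := fun β => ∑ m ∈ f.support, monomial m (b.repr (f.coeff m) β)
  have hcoeff : ∀ m ∈ f.support,
      (∑ β ∈ S, (b.repr (f.coeff m) β) • ((β : J) : L)) = f.coeff m := by
    intro m hm
    have h1 : (b.repr (f.coeff m)).sum (fun β r => r • b β) = f.coeff m := by
      have := b.linearCombination_repr (f.coeff m)
      rwa [Finsupp.linearCombination_apply] at this
    have hsub : (b.repr (f.coeff m)).support ⊆ S := fun β hβ =>
      Finset.mem_biUnion.2 ⟨m, hm, hβ⟩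
    calc (∑ β ∈ S, (b.repr (f.coeff m) β) • ((β : J) : L))
        = ∑ β ∈ S, (b.repr (f.coeff m) β) • b β := by
          refine Finset.sum_congr rfl fun β _ => ?_
          rw [hb, Module.Basis.ofVectorSpace_apply_self]
      _ = (b.repr (f.coeff m)).sum (fun β r => r • b β) :=
          (Finsupp.sum_of_support_subset _ hsub (fun β r => r • b β) (fun β _ => zero_smul _ _)).symm
      _ = f.coeff m := h1
  have hsum : f = ∑ β ∈ S, ((β : J) : L) • map (algebraMap k L) (g₀ β) := by
    have h2 : ∀ β ∈ S, ((β : J) : L) • map (algebraMap k L) (g₀ β) =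
        ∑ m ∈ f.support, monomial m (((β : J) : L) * algebraMap k L (b.repr (f.coeff m) β)) := by
      intro β _
      simp only [g₀, map_sum, map_monomial, Finset.smul_sum, smul_monomial, smul_eq_mul]
    rw [Finset.sum_congr rfl h2, Finset.sum_comm]
    conv_lhs => rw [f.as_sum]
    refine Finset.sum_congr rfl fun m hm => ?_
    rw [← map_sum (monomial m)]
    congr 1
    conv_lhs => rw [← hcoeff m hm]
    refine Finset.sum_congr rfl fun β _ => ?_
    rw [Algebra.smul_def, mul_comm]
  have hvan : ∀ β ∈ S, ∀ a ∈ A, eval a (g₀ β) = 0 := by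
    intro β hβ a ha
    have h0 := hf a ha
    rw [hsum, map_sum] at h0
    simp only [map_smul, aeval_map_algebraMap] at h0
    have h3 : ∑ β ∈ S, (eval a (g₀ β)) • ((β : J) : L) = 0 := by
      rw [← h0]
      refine Finset.sum_congr rfl fun β _ => ?_
      rw [aeval_algebraMap_comp_eq, Algebra.smul_def, smul_eq_mul, mul_comm]
    have hli := Module.Basis.ofVectorSpaceIndex.linearIndependent (K := k) (V := L)
    rw [linearIndependent_iff'] at hli
    exact hli S (fun β => eval a (g₀ β)) h3 β hβ
  have hsupp : ∀ β, (g₀ β).support ⊆ f.support := by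
    intro β m hm
    by_contra hnot
    apply (mem_support_iff.1 hm)
    simp only [g₀, coeff_sum, coeff_monomial]
    refine Finset.sum_eq_zero fun m' hm' => ?_
    rw [if_neg]
    rintro rfl
    exact hnot hm'
  -- reindex by `Fin n`
  refine ⟨S.card, fun i => ((S.equivFin.symm i : J) : L), fun i => g₀ (S.equivFin.symm i), ?_,
    fun i => hvan _ (S.equivFin.symm i).2, fun i => hsupp _⟩
  rw [hsum, ← Finset.sum_coe_sort S]
  exact (Fintype.sum_equiv S.equivFin.symm _ _ fun i => rfl).symm

/-- **A principal vanishing ideal of a set of `k`-points has a `k`-rational generator.** If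
`f ≠ 0` vanishes on the `k`-points `A` and divides every `L`-polynomial vanishing on `A`, then
`f = κ · g` for a constant `κ ∈ Lˣ` and a polynomial `g ∈ k[X_ι]` (which then vanishes on `A`).
[folklore] -/
theorem exists_eq_C_mul_map_of_forall_dvd (A : Set (ι → k)) {f : MvPolynomial ι L} (hf0 : f ≠ 0)
    (hfA : ∀ a ∈ A, aeval (fun i => algebraMap k L (a i)) f = 0)
    (hdvd : ∀ p : MvPolynomial ι L, (∀ a ∈ A, aeval (fun i => algebraMap k L (a i)) p = 0) → f ∣ p) :
    ∃ (κ : L) (g : MvPolynomial ι k), κ ≠ 0 ∧ g ≠ 0 ∧ (∀ a ∈ A, eval a g = 0) ∧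
      f = C κ * map (algebraMap k L) g := by
  classical
  obtain ⟨n, c, g, hfsum, hg, hsupp⟩ := exists_sum_smul_map_of_forall_aeval_eq_zero A f hfA
  -- some `gᵢ` is non-zero
  have hex : ∃ i, g i ≠ 0 := by
    by_contra! h
    apply hf0
    rw [hfsum]
    exact Finset.sum_eq_zero fun i _ => by rw [h i, map_zero, smul_zero]
  obtain ⟨i, hi⟩ := hex
  have hinj : Function.Injective (algebraMap k L) := (algebraMap k L).injective
  have hgi0 : map (algebraMap k L) (g i) ≠ 0 := by
    intro h
    exact hi (map_injective _ hinj (by rw [h, map_zero]))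
  -- `f ∣ gᵢ`
  have hfi : f ∣ map (algebraMap k L) (g i) := by
    refine hdvd _ fun a ha => ?_
    rw [aeval_map_algebraMap, aeval_algebraMap_comp_eq, hg i a ha, map_zero]
  obtain ⟨h, hh⟩ := hfi
  have hh0 : h ≠ 0 := by
    rintro rfl
    exact hgi0 (by rw [hh, mul_zero])
  -- degree count: `deg gᵢ ≤ deg f`, `deg gᵢ = deg f + deg h`
  have hdeg : (map (algebraMap k L) (g i)).totalDegree = f.totalDegree + h.totalDegree := by
    rw [hh, totalDegree_mul_of_isDomain hf0 hh0]
  have hle : (map (algebraMap k L) (g i)).totalDegree ≤ f.totalDegree :=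
    (totalDegree_le_of_support_subset (support_map_subset _ _)).trans
      (totalDegree_le_of_support_subset (hsupp i))
  have hh0' : h.totalDegree = 0 := by omega
  rw [totalDegree_eq_zero_iff_eq_C] at hh0'
  set κ := h.coeff 0 with hκ
  have hc0 : κ ≠ 0 := by
    intro h0
    exact hh0 (by rw [hh0', h0, map_zero])
  refine ⟨κ⁻¹, g i, inv_ne_zero hc0, hi, hg i, ?_⟩
  rw [hh, hh0', mul_comm f, ← mul_assoc, ← map_mul, inv_mul_cancel₀ hc0, map_one, one_mul]

/-- **Absolute irreducibility over an algebraically closed field.** If `k` is algebraically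
closed and `G ∈ k[X_ι]` (finitely many variables) is prime, then `G` remains prime in `L[X_ι]`
for every field extension `L` of `k`: irreducible `k`-varieties are geometrically irreducible.
[folklore] -/
theorem prime_map_of_isAlgClosed [IsAlgClosed k] [Finite ι] {G : MvPolynomial ι k}
    (hG : Prime G) : Prime (map (algebraMap k L) G) := by
  classical
  have hinj : Function.Injective (algebraMap k L) := (algebraMap k L).injective
  set G' := map (algebraMap k L) G with hG'
  have hG0 : G ≠ 0 := hG.ne_zero
  have hG'0 : G' ≠ 0 := fun h => hG0 (map_injective _ hinj (by rw [← hG', h, map_zero]))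
  have htdeg : G'.totalDegree = G.totalDegree := by
    simp only [totalDegree, hG', support_map_of_injective _ hinj]
  -- the `k`-points of `Z(G)`
  set Z : Set (ι → k) := zeroLocus k (Ideal.span {G}) with hZ
  have hZG : ∀ a ∈ Z, eval a G = 0 := fun a ha => by
    have := (mem_zeroLocus_iff.1 ha) G (Ideal.subset_span rfl)
    rwa [aeval_eq_eval] at this
  have hrad : vanishingIdeal k Z = Ideal.span {G} := by
    rw [hZ, vanishingIdeal_zeroLocus_eq_radical]
    exact ((Ideal.span_singleton_prime hG0).2 hG).radical
  -- a `k`-polynomial vanishing on the part of `Z` where an `L`-factor vanishes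
  have key : ∀ A : MvPolynomial ι L, A ≠ 0 →
      ∃ A₁ : MvPolynomial ι k, A₁ ≠ 0 ∧ A₁.totalDegree ≤ A.totalDegree ∧
        ∀ a ∈ Z, aeval (fun i => algebraMap k L (a i)) A = 0 → eval a A₁ = 0 := by
    intro A hA
    obtain ⟨n, c, g, hsum, hg, hsupp⟩ := exists_sum_smul_map_of_forall_aeval_eq_zero
      {a ∈ Z | aeval (fun i => algebraMap k L (a i)) A = 0} A (fun a ha => ha.2)
    have hex : ∃ i, g i ≠ 0 := by
      by_contra! h
      apply hA
      rw [hsum]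
      exact Finset.sum_eq_zero fun i _ => by rw [h i, map_zero, smul_zero]
    obtain ⟨i, hi⟩ := hex
    exact ⟨g i, hi, totalDegree_le_of_support_subset (hsupp i),
      fun a ha hA => hg i a ⟨ha, hA⟩⟩
  refine ⟨hG'0, ?_, ?_⟩
  · -- not a unit
    intro hu
    rw [isUnit_iff_eq_C_of_isReduced] at hu
    obtain ⟨r, hr, hr'⟩ := hu
    have h0 : G.totalDegree = 0 := by rw [← htdeg, hr', totalDegree_C]
    rw [totalDegree_eq_zero_iff_eq_C] at h0
    apply hG.not_unit
    rw [h0]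
    refine IsUnit.map C (Ne.isUnit ?_)
    intro hc
    exact hG0 (by rw [h0, hc, map_zero])
  · -- `G' ∣ A * B → G' ∣ A ∨ G' ∣ B`, via the degree count on a factorisation of `G'`
    -- we prove the equivalent irreducibility-type statement first
    intro A B hAB
    -- reduce to: whenever `G' = A * B`, one factor is a unit; use UFD-primality of irreducibles
    -- Strategy: show `Irreducible G'` and conclude with `Irreducible.prime`.
    have hirr : Irreducible G' := by
      refine ⟨fun hu => ?_, fun A B hAB => ?_⟩
      · rw [isUnit_iff_eq_C_of_isReduced] at hu
        obtain ⟨r, hr, hr'⟩ := hu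
        have h0 : G.totalDegree = 0 := by rw [← htdeg, hr', totalDegree_C]
        rw [totalDegree_eq_zero_iff_eq_C] at h0
        apply hG.not_unit
        rw [h0]
        refine IsUnit.map C (Ne.isUnit ?_)
        intro hc
        exact hG0 (by rw [h0, hc, map_zero])
      · have hA : A ≠ 0 := fun h => hG'0 (by rw [hAB, h, zero_mul])
        have hB : B ≠ 0 := fun h => hG'0 (by rw [hAB, h, mul_zero])
        have hdegAB : G.totalDegree = A.totalDegree + B.totalDegree := by
          rw [← htdeg, hAB, totalDegree_mul_of_isDomain hA hB]
        obtain ⟨A₁, hA₁, hdA, hvA⟩ := key A hA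
        obtain ⟨B₁, hB₁, hdB, hvB⟩ := key B hB
        -- `A₁ * B₁` vanishes on `Z`, hence `G ∣ A₁ * B₁`
        have hmem : A₁ * B₁ ∈ vanishingIdeal k Z := by
          rw [mem_vanishingIdeal_iff]
          intro a ha
          rw [aeval_eq_eval, map_mul]
          have hprod : aeval (fun i => algebraMap k L (a i)) A *
              aeval (fun i => algebraMap k L (a i)) B = 0 := by
            rw [← map_mul, ← hAB, hG', aeval_map_algebraMap, aeval_algebraMap_comp_eq,
              hZG a ha, map_zero]
          rcases mul_eq_zero.1 hprod with h | h
          · rw [hvA a ha h, zero_mul]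
          · rw [hvB a ha h, mul_zero]
        rw [hrad, Ideal.mem_span_singleton] at hmem
        rcases hG.dvd_or_dvd hmem with ⟨H, hH⟩ | ⟨H, hH⟩
        · -- `deg G ≤ deg A₁ ≤ deg A`, so `deg B = 0`
          have hH0 : H ≠ 0 := fun h => hA₁ (by rw [hH, h, mul_zero])
          have h1 : A₁.totalDegree = G.totalDegree + H.totalDegree := by
            rw [hH, totalDegree_mul_of_isDomain hG0 hH0]
          have hB0 : B.totalDegree = 0 := by omega
          rw [totalDegree_eq_zero_iff_eq_C] at hB0
          refine Or.inr ?_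
          rw [hB0]
          refine IsUnit.map C (Ne.isUnit ?_)
          intro hc
          exact hB (by rw [hB0, hc, map_zero])
        · have hH0 : H ≠ 0 := fun h => hB₁ (by rw [hH, h, mul_zero])
          have h1 : B₁.totalDegree = G.totalDegree + H.totalDegree := by
            rw [hH, totalDegree_mul_of_isDomain hG0 hH0]
          have hA0 : A.totalDegree = 0 := by omega
          rw [totalDegree_eq_zero_iff_eq_C] at hA0
          refine Or.inl ?_
          rw [hA0]
          refine IsUnit.map C (Ne.isUnit ?_)
          intro hc
          exact hA (by rw [hA0, hc, map_zero])
    exact hirr.prime.dvd_or_dvd hAB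

end

end Literature.RingTheory.Nullstellensatz
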